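import Summits.QuantumFields.YangMills.Theorems.UnitScaleTiltProp8FlatProp4Background1
import HarnessLib

/-!
# Route `UnitScaleTilt`, crux K1 child «MinimiserStabilityRegPr» (stmt-QuantumFields-19200), registered stub V2′ `stub_halvingStep`
# (skeletons v8 5b4e846794b80374 ∕ v10 `BirthV10`) — **THE (73)-CLASS TRANSPOSE LETTERS OF THE DRESSING TERMS** (owner WANTED №g26-1 row (X2);
# ★★OWNER g26 ASSIGNMENTS 8 (b) 2026-08-28T04:57:06Z: «(X2-T) `T_{A′}ᵀ = (H∘D′(A′))ᵀ` on w₃-currents and (X2-D) the `D′(A′)ᵀ` transpose letter»)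

Cell `ym3-torus` (HUMAN RULING D-0037, YM ladder rung R3 — continuum SU(2) YM₃ on the torus is a RUNG, not the Clay problem), width seat
`ym-ust-19936-w8` gen 0 (D-0154 (3c)).  `--supports stmt-QuantumFields-19200 --as helper`; def-free, 0 sorry, standard axioms.

WHY.  ✓ p605698 `HalvingDressedCriticality.fderiv_dressed_eq_pairing` makes the dressing current of [Balaban1985Variational] (80)∕(84)–(89) EXPLICIT:
`E Y = −½·CC(H(D Y)) − T_Yᵀ[½·CC(ΨY)] − T_Yᵀ[W₀(ΨY)]`, `Ψ = 1 − H∘D`, `T_Y = H∘D′(Y)`, `D′(Y) = fderiv ℂ D Y`, where the transpose for the trace pairing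
`Σ_b tr(X_b δ_b)` of a ℂ-linear `T` is read on matrix units, `(Tᵀ J)_b = (Σ_{b′} tr(J_{b′}·(T e_{b,ji})_{b′}))_{ij}`, `e_{b,ji} = Pi.single b (Matrix.single j i 1)`.
The M2 knit (`…HalvingDressingLetter`, seat 19200-w6) needs the quadratic letter `C_E` of ✓ p598408 `FlatProp4Dressing.hWq_of_dressing` for this `E`, hence
BOUNDS FOR `T_Yᵀ` AND `D′(Y)ᵀ` ON `w₃`-CURRENTS — print's (73) *«its functional derivative satisfies the bound (73)»* and its uses (85)–(89).  Print proves (73)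
as an exponential-decay KERNEL estimate ((66)–(72): Neumann series over [3] Lemma 2.1 and [4] Prop. 5); the tree holds it only at NORM level for a Banach model
(lit-balaban `B11Prop3Model.norm_fderiv_Dfix_le`, sup → sup), which does not transpose.

THE MECHANISM TYPED HERE (finite-dimensional, exact).  A bound for `Tᵀ` on weighted-sup currents (`w b·‖J b‖ ≤ t`) is EQUIVALENT to a bound for `T` on the
dual weighted-ℓ¹ norm `Σ_b (w b)⁻¹‖δ b‖`; and differentiating the fixed-point equation (49) `D(X) = C(X − H·D(X))` gives `D′δ = C′(δ − H·D′δ)`, `C′ = fderiv ℂ C (ΨY)`,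
whence the ℓ¹ bound of `D′` follows from TWO COLUMN LETTERS — (X2-C′) for `C′` (ℓ¹(fine, `w⁻¹`) → ℓ¹(index, `u`), constant `c₃ = O(size ΨY)`: the (72)∕[4] (157)
input) and (X2-H) for `H` (ℓ¹(index, `u`) → ℓ¹(fine, `w⁻¹`), constant `h₁`: the column form of (46)∕[5] Thm 3.12) — by the a-priori estimate `a ≤ c₃(S + h₁a)`,
`c₃h₁ ≤ ½ ⇒ a ≤ 2c₃S` (no Neumann series needed).  ONE shared index weight `u : β′ → ℝ` (at the cube sequence: `u c = η⁻³(L^{j(c)}η)⁻¹`, `(w 3 b)⁻¹ = (L^{j(b)}η)⁻³`).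

WHAT THIS FILE PROVES (generic finite index types `ι` (fine bonds), `β′`∕`κ` (index bonds); `M₂ = Matrix (Fin 2) (Fin 2) ℂ` with the L²-operator norm):
* §1 (dual-weight ℓ¹ algebra, any seminormed `V`): `l1_comp`; ★ **`l1_fderivD_of_fixedPoint`** (`Σ_c u_c‖D′δ c‖ ≤ 2c₃·Σ_b v_b‖δ b‖`); `l1_HD_of_fixedPoint`
  (`Σ_b v_b‖H(D′δ) b‖ ≤ 2h₁c₃·Σ_b v_b‖δ b‖`); **`fderiv_fixedPoint_apply`** — the identity `D′δ = C′(δ − H·D′δ)` for `D′ := fderiv ℂ D Y` from (49) near `Y`.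
* §2 (trace-pairing transposes on `M₂`): `norm_sum_trace_mul_le`, `pairing_le_of_current`, `l1_single`, `norm_le_sum_norm_entries`, ★ **`norm_transposeCurrent_le`** —
  an ℓ¹(`v` → `u`) bound `C_T` for ANY ℂ-linear `T : (ι → M₂) → (κ → M₂)` and a current `‖Z c‖ ≤ β·u c` give `‖(Tᵀ Z)_b‖ ≤ 8βC_T·v b`.
* §3 THE LETTERS in the knit's currency (`v := w⁻¹`, `0 < w`): ★★ **`X2D_letter`** (`w b·‖(D′ᵀξ)_b‖ ≤ 16c₃·β` for `‖ξ c‖ ≤ β·u c`), ★★ **`X2T_letter`**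
  (`w b·‖(T_Yᵀ J)_b‖ ≤ 16h₁c₃·t` for `w·‖J‖ ≤ t` — the owner's (X2-T) shape with `B₃ := 16h₁c₃`, O(r) through `c₃`), ★★ **`X2a_of_X2D_CCHt`** (the composite
  (X2a) of the knit: `w b·‖(T_Yᵀ[CC Z])_b‖ ≤ 8c₃B_CH·s` for ANY trace-symmetric ℂ-linear `CC` with the (X2-CH) column letter `|Σ_b tr(CC(HX)_b Z_b)| ≤ B_CH·s·Σ_c u_c‖X c‖`
  at the field `Z` — print's routing (88) of the `⟨A′, ΔHD(A′)⟩` term through `Hᵀ∂*∂ = ((QGQ*)⁻¹ − a)ᵀQ` first); and the same three AT `D′ := fderiv ℂ D Y`,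
  `C′ := fderiv ℂ C (Y − H(D Y))` with `hfix` DISCHARGED from (49) near `Y`: **`X2D_letter_fderiv`**, **`X2T_letter_fderiv`** (verbatim the `H (fderiv ℂ D Y e_{b,ji})`
  shape of `fderiv_dressed_eq_pairing`'s `E₃`), **`X2a_fderiv`**.
HONEST SCOPE.  Exact finite-dimensional algebra and norm bookkeeping; NO lattice estimate is proved: the column letters (X2-H), (X2-C′), (X2-CH) are DISPLAYED
hypotheses (the (73)∕(3.132)-class content, supplier rows for the chart `D`∕`H` of record); `D`, `C`, `H`, `CC` are abstract.  NOT a claim about the stub, the crux,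
the rung or the mass gap.

References: T. Bałaban, CMP **102** (1985) 277–309 [Balaban1985Variational] (46)–(49) p.285, (55) p.286, (63)–(73) pp.287–289, (80)–(89) pp.290–291, (157)–(158) p.302.
-/

set_option autoImplicit false

noncomputable section

open scoped BigOperators Matrix.Norms.L2Operator
open Filter Topology

namespace Summit.QuantumFields.YangMills.Theorems.DressingTransposeLetters

open Summit.QuantumFields.YangMills.Theorems.FlatPlaqDeriv (norm_trace_mul_le)
open Summit.QuantumFields.YangMills.Theorems.FlatProp4Bg1 (norm_single_le_one)

/-! ## §1 Dual-weight ℓ¹ bounds: composition, and the derivative of the fixed point (49) -/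

section L1

variable {ι β' κ : Type*} [Fintype ι] [Fintype β'] [Fintype κ] {V : Type*} [SeminormedAddCommGroup V] [NormedSpace ℂ V]

/-- Composition of dual-weight ℓ¹ bounds: if `T₁ : ℓ¹(v) → ℓ¹(u)` has constant `C₁` and `T₂ : ℓ¹(u) → ℓ¹(v′)` has constant `C₂ ≥ 0`, then `T₂ ∘ T₁` has
constant `C₂C₁`. [folklore] -/
theorem l1_comp (T₁ : (ι → V) →ₗ[ℂ] (β' → V)) (T₂ : (β' → V) →ₗ[ℂ] (κ → V)) (v : ι → ℝ) (u : β' → ℝ) (v' : κ → ℝ) {C₁ C₂ : ℝ}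
    (hC₂ : 0 ≤ C₂) (h₁ : ∀ δ, ∑ c, u c * ‖T₁ δ c‖ ≤ C₁ * ∑ b, v b * ‖δ b‖) (h₂ : ∀ X, ∑ a, v' a * ‖T₂ X a‖ ≤ C₂ * ∑ c, u c * ‖X c‖)
    (δ : ι → V) : ∑ a, v' a * ‖T₂ (T₁ δ) a‖ ≤ C₂ * C₁ * ∑ b, v b * ‖δ b‖ :=
  calc ∑ a, v' a * ‖T₂ (T₁ δ) a‖ ≤ C₂ * ∑ c, u c * ‖T₁ δ c‖ := h₂ (T₁ δ)
    _ ≤ C₂ * (C₁ * ∑ b, v b * ‖δ b‖) := mul_le_mul_of_nonneg_left (h₁ δ) hC₂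
    _ = C₂ * C₁ * ∑ b, v b * ‖δ b‖ := by ring

/-- ★ **THE ℓ¹ BOUND OF THE DERIVATIVE OF THE FIXED POINT (49)** — the core of the (X2-D) letter.  If three ℂ-linear maps satisfy the differentiated
fixed-point identity `D′δ = C′(δ − H·D′δ)` ((66)–(68): `(1 + C′H)D′ = C′`), `C′` has the dual-weight column letter `Σ_c u_c‖C′δ c‖ ≤ c₃·Σ_b v_b‖δ b‖`
((72)-class) and `H` the column letter `Σ_b v_b‖HX b‖ ≤ h₁·Σ_c u_c‖X c‖` ((46)-class), with `c₃h₁ ≤ ½`, then `Σ_c u_c‖D′δ c‖ ≤ 2c₃·Σ_b v_b‖δ b‖` — the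
a-priori form of print's Neumann step (70)–(71) *«Equation (68) is uniquely solvable by a convergent Neumann series … ‖(I + ℜ)⁻¹‖ ≤ 2»*.
[cite: Balaban1985Variational, (66)-(73) pp.288-289] -/
theorem l1_fderivD_of_fixedPoint (D' C' : (ι → V) →ₗ[ℂ] (β' → V)) (H : (β' → V) →ₗ[ℂ] (ι → V)) (v : ι → ℝ) (u : β' → ℝ) {c₃ h₁ : ℝ}
    (hv : ∀ b, 0 ≤ v b) (hu : ∀ c, 0 ≤ u c) (hc₃ : 0 ≤ c₃)
    (hfix : ∀ δ, D' δ = C' (δ - H (D' δ)))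
    (hC : ∀ δ, ∑ c, u c * ‖C' δ c‖ ≤ c₃ * ∑ b, v b * ‖δ b‖)
    (hH : ∀ X, ∑ b, v b * ‖H X b‖ ≤ h₁ * ∑ c, u c * ‖X c‖)
    (hsmall : c₃ * h₁ ≤ 1 / 2) (δ : ι → V) :
    ∑ c, u c * ‖D' δ c‖ ≤ 2 * c₃ * ∑ b, v b * ‖δ b‖ := by
  set a : ℝ := ∑ c, u c * ‖D' δ c‖ with ha
  set S : ℝ := ∑ b, v b * ‖δ b‖ with hS
  have ha0 : 0 ≤ a := Finset.sum_nonneg fun c _ => mul_nonneg (hu c) (norm_nonneg _)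
  have hfixc : ∀ c, D' δ c = C' (δ - H (D' δ)) c := fun c => congrArg (fun f => f c) (hfix δ)
  -- `a = Σ u‖C′(δ − H D′δ)‖ ≤ c₃·Σ v‖δ − H D′δ‖ ≤ c₃·(S + h₁·a)`
  have h1 : a ≤ c₃ * ∑ b, v b * ‖(δ - H (D' δ)) b‖ := by
    have : a = ∑ c, u c * ‖C' (δ - H (D' δ)) c‖ := Finset.sum_congr rfl fun c _ => by rw [hfixc c]
    rw [this]
    exact hC _
  have h2 : ∑ b, v b * ‖(δ - H (D' δ)) b‖ ≤ S + ∑ b, v b * ‖H (D' δ) b‖ := by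
    rw [hS, ← Finset.sum_add_distrib]
    refine Finset.sum_le_sum fun b _ => ?_
    rw [← mul_add]
    exact mul_le_mul_of_nonneg_left (by rw [Pi.sub_apply]; exact norm_sub_le _ _) (hv b)
  have h3 : ∑ b, v b * ‖H (D' δ) b‖ ≤ h₁ * a := hH (D' δ)
  have h4 : a ≤ c₃ * S + c₃ * h₁ * a := by
    calc a ≤ c₃ * (S + ∑ b, v b * ‖H (D' δ) b‖) := h1.trans (mul_le_mul_of_nonneg_left h2 hc₃)
      _ ≤ c₃ * (S + h₁ * a) := mul_le_mul_of_nonneg_left (add_le_add le_rfl h3) hc₃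
      _ = c₃ * S + c₃ * h₁ * a := by ring
  have h5 : c₃ * h₁ * a ≤ 1 / 2 * a := mul_le_mul_of_nonneg_right hsmall ha0
  linarith

/-- The ℓ¹ bound of `T_Y = H∘D′(Y)` (the map whose transpose carries the dressing terms (86)∕(89)): under the hypotheses of `l1_fderivD_of_fixedPoint` and
`0 ≤ h₁`, `Σ_b v_b‖H(D′δ) b‖ ≤ 2h₁c₃·Σ_b v_b‖δ b‖`. [cite: Balaban1985Variational, (73) p.289, (86) p.291, (89) p.291] -/
theorem l1_HD_of_fixedPoint (D' C' : (ι → V) →ₗ[ℂ] (β' → V)) (H : (β' → V) →ₗ[ℂ] (ι → V)) (v : ι → ℝ) (u : β' → ℝ) {c₃ h₁ : ℝ}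
    (hv : ∀ b, 0 ≤ v b) (hu : ∀ c, 0 ≤ u c) (hc₃ : 0 ≤ c₃) (hh₁ : 0 ≤ h₁)
    (hfix : ∀ δ, D' δ = C' (δ - H (D' δ)))
    (hC : ∀ δ, ∑ c, u c * ‖C' δ c‖ ≤ c₃ * ∑ b, v b * ‖δ b‖)
    (hH : ∀ X, ∑ b, v b * ‖H X b‖ ≤ h₁ * ∑ c, u c * ‖X c‖)
    (hsmall : c₃ * h₁ ≤ 1 / 2) (δ : ι → V) :
    ∑ b, v b * ‖H (D' δ) b‖ ≤ 2 * h₁ * c₃ * ∑ b, v b * ‖δ b‖ := by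
  have h := l1_comp D' H v u v hh₁ (l1_fderivD_of_fixedPoint D' C' H v u hv hu hc₃ hfix hC hH hsmall) hH δ
  calc ∑ b, v b * ‖H (D' δ) b‖ ≤ h₁ * (2 * c₃) * ∑ b, v b * ‖δ b‖ := h
    _ = 2 * h₁ * c₃ * ∑ b, v b * ‖δ b‖ := by ring

end L1

section Derivative

variable {ι β' : Type*} [Fintype ι] [Fintype β'] {V : Type*} [NormedAddCommGroup V] [NormedSpace ℂ V] [FiniteDimensional ℂ V]

/-- **THE DIFFERENTIATED FIXED-POINT EQUATION** ((66)–(68)): if `D(X) = C(X − H·D(X))` for `X` near `Y` ((49) on the chart's ball), `D` is differentiable at `Y`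
and `C` at `ΨY = Y − H·D(Y)`, then `D′(Y)δ = C′(ΨY)(δ − H·D′(Y)δ)` for every `δ` (`D′ = fderiv ℂ D Y`, `C′ = fderiv ℂ C (ΨY)`; chain rule and locality of
`fderiv`). [cite: Balaban1985Variational, (49) p.285, (63)-(68) pp.287-288] -/
theorem fderiv_fixedPoint_apply (C D : (ι → V) → (β' → V)) (H : (β' → V) →ₗ[ℂ] (ι → V)) {Y : ι → V}
    (h49 : ∀ᶠ X in 𝓝 Y, D X = C (X - H (D X))) (hD : DifferentiableAt ℂ D Y) (hC : DifferentiableAt ℂ C (Y - H (D Y))) (δ : ι → V) :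
    fderiv ℂ D Y δ = fderiv ℂ C (Y - H (D Y)) (δ - H (fderiv ℂ D Y δ)) := by
  have hH : HasFDerivAt (fun X : ι → V => (LinearMap.toContinuousLinearMap H) (D X))
      ((LinearMap.toContinuousLinearMap H).comp (fderiv ℂ D Y)) Y :=
    (LinearMap.toContinuousLinearMap H).hasFDerivAt.comp Y hD.hasFDerivAt
  have hΨ : HasFDerivAt (fun X : ι → V => X - H (D X))
      ((ContinuousLinearMap.id ℂ _) - (LinearMap.toContinuousLinearMap H).comp (fderiv ℂ D Y)) Y :=
    (hasFDerivAt_id Y).sub hH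
  have hcomp : HasFDerivAt (fun X : ι → V => C (X - H (D X)))
      ((fderiv ℂ C (Y - H (D Y))).comp ((ContinuousLinearMap.id ℂ _) - (LinearMap.toContinuousLinearMap H).comp (fderiv ℂ D Y))) Y :=
    hC.hasFDerivAt.comp Y hΨ
  have heq : fderiv ℂ D Y = fderiv ℂ (fun X : ι → V => C (X - H (D X))) Y :=
    Filter.EventuallyEq.fderiv_eq (h49.mono fun X hX => hX)
  -- evaluate: the right-hand side still contains `fderiv ℂ D Y δ`, which we keep
  have h := congrArg (fun L : (ι → V) →L[ℂ] (β' → V) => L δ) (heq.trans hcomp.fderiv)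
  simp only [ContinuousLinearMap.comp_apply, sub_apply, ContinuousLinearMap.id_apply,
    LinearMap.coe_toContinuousLinearMap'] at h
  exact h

end Derivative

/-! ## §2 Transposes for the trace pairing `Σ_b tr(X_b δ_b)` on `M₂(ℂ)`-valued fields -/

section Transpose

variable {ι κ : Type*} [Fintype ι] [Fintype κ] [DecidableEq ι]

/-- `‖Σ_c tr(Z_c X_c)‖ ≤ 2·Σ_c ‖Z_c‖‖X_c‖` (2 × 2 matrices, L²-operator norm; `FlatPlaqDeriv.norm_trace_mul_le`). [cite: Balaban1985Variational, (5) p.278, (27) p.282] -/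
theorem norm_sum_trace_mul_le (Z X : κ → Matrix (Fin 2) (Fin 2) ℂ) :
    ‖∑ c, Matrix.trace (Z c * X c)‖ ≤ 2 * ∑ c, ‖Z c‖ * ‖X c‖ := by
  refine (norm_sum_le _ _).trans ?_
  rw [Finset.mul_sum]
  refine Finset.sum_le_sum fun c _ => ?_
  calc ‖Matrix.trace (Z c * X c)‖ ≤ 2 * ‖Z c‖ * ‖X c‖ := norm_trace_mul_le _ _
    _ = 2 * (‖Z c‖ * ‖X c‖) := by ring

/-- The trace pairing of a DUAL-WEIGHTED current with a field is bounded by the dual-weight ℓ¹ norm: `‖Z c‖ ≤ β·u c ∀ c` ⟹ `‖Σ_c tr(Z_c X_c)‖ ≤ 2β·Σ_c u_c‖X_c‖`.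
[cite: Balaban1985Variational, (27) p.282, (85) p.291] -/
theorem pairing_le_of_current (Z X : κ → Matrix (Fin 2) (Fin 2) ℂ) (u : κ → ℝ) {β : ℝ} (hZ : ∀ c, ‖Z c‖ ≤ β * u c) :
    ‖∑ c, Matrix.trace (Z c * X c)‖ ≤ 2 * β * ∑ c, u c * ‖X c‖ := by
  refine (norm_sum_trace_mul_le Z X).trans ?_
  rw [mul_assoc, Finset.mul_sum, Finset.mul_sum, Finset.mul_sum]
  refine Finset.sum_le_sum fun c _ => ?_
  have h : ‖Z c‖ * ‖X c‖ ≤ β * u c * ‖X c‖ := mul_le_mul_of_nonneg_right (hZ c) (norm_nonneg _)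
  calc 2 * (‖Z c‖ * ‖X c‖) ≤ 2 * (β * u c * ‖X c‖) := by linarith
    _ = 2 * (β * (u c * ‖X c‖)) := by ring

/-- The dual-weight ℓ¹ norm of a matrix-unit field: `Σ_{b′} v_{b′}‖(e_{b,ji})_{b′}‖ ≤ v_b` (`‖Matrix.single j i 1‖ ≤ 1`, `FlatProp4Bg1.norm_single_le_one`). [folklore] -/
theorem l1_single (v : ι → ℝ) (hv : ∀ b, 0 ≤ v b) (b : ι) (i j : Fin 2) :
    ∑ b', v b' * ‖(Pi.single b (Matrix.single j i (1 : ℂ)) : ι → Matrix (Fin 2) (Fin 2) ℂ) b'‖ ≤ v b := by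
  rw [Finset.sum_eq_single b]
  · rw [Pi.single_eq_same]
    calc v b * ‖(Matrix.single j i (1 : ℂ) : Matrix (Fin 2) (Fin 2) ℂ)‖ ≤ v b * 1 := mul_le_mul_of_nonneg_left (norm_single_le_one i j) (hv b)
      _ = v b := mul_one _
  · intro b' _ hb'
    rw [Pi.single_eq_of_ne hb', norm_zero, mul_zero]
  · intro h; exact absurd (Finset.mem_univ b) h

/-- The L²-operator norm of a 2 × 2 matrix is at most the sum of the norms of its entries (`M = Σ_{ij} M_{ij}•E_{ij}`, `‖E_{ij}‖ ≤ 1`). [folklore] -/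
theorem norm_le_sum_norm_entries (M : Matrix (Fin 2) (Fin 2) ℂ) : ‖M‖ ≤ ∑ i, ∑ j, ‖M i j‖ := by
  conv_lhs => rw [Matrix.matrix_eq_sum_single M]
  refine (norm_sum_le _ _).trans (Finset.sum_le_sum fun i _ => (norm_sum_le _ _).trans (Finset.sum_le_sum fun j _ => ?_))
  have h : (Matrix.single i j (M i j) : Matrix (Fin 2) (Fin 2) ℂ) = M i j • (Matrix.single i j (1 : ℂ) : Matrix (Fin 2) (Fin 2) ℂ) := by
    rw [Matrix.smul_single, smul_eq_mul, mul_one]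
  rw [h, norm_smul]
  calc ‖M i j‖ * ‖(Matrix.single i j (1 : ℂ) : Matrix (Fin 2) (Fin 2) ℂ)‖ ≤ ‖M i j‖ * 1 := mul_le_mul_of_nonneg_left (norm_single_le_one j i) (norm_nonneg _)
    _ = ‖M i j‖ := mul_one _

/-- ★ **THE TRANSPOSED CURRENT OF A ℂ-LINEAR MAP WITH A DUAL-WEIGHT ℓ¹ BOUND**: if `Σ_c u_c‖Tδ c‖ ≤ C_T·Σ_b v_b‖δ b‖` for all `δ` (`0 ≤ C_T`, `0 ≤ v`) and the
current `Z` obeys `‖Z c‖ ≤ β·u c` (`0 ≤ β`), then the transposed current read on matrix units, `(Tᵀ Z)_b = (Σ_c tr(Z_c·(T e_{b,ji})_c))_{ij}`, satisfies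
`‖(Tᵀ Z)_b‖ ≤ 8βC_T·v_b` — i.e. `Tᵀ` maps `u`-dual currents to `v`-dual currents (`v = w₃⁻¹`: to `w₃`-currents). [cite: Balaban1985Variational, (73) p.289, (85)-(86) p.291] -/
theorem norm_transposeCurrent_le (T : (ι → Matrix (Fin 2) (Fin 2) ℂ) →ₗ[ℂ] (κ → Matrix (Fin 2) (Fin 2) ℂ)) (v : ι → ℝ) (u : κ → ℝ) {C_T β : ℝ}
    (hv : ∀ b, 0 ≤ v b) (hC_T : 0 ≤ C_T) (hβ : 0 ≤ β)
    (hT : ∀ δ, ∑ c, u c * ‖T δ c‖ ≤ C_T * ∑ b, v b * ‖δ b‖)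
    (Z : κ → Matrix (Fin 2) (Fin 2) ℂ) (hZ : ∀ c, ‖Z c‖ ≤ β * u c) (b : ι) :
    ‖Matrix.of (fun i j : Fin 2 => ∑ c, Matrix.trace (Z c * T (Pi.single b (Matrix.single j i (1 : ℂ))) c))‖ ≤ 8 * β * C_T * v b := by
  have hentry : ∀ i j : Fin 2, ‖∑ c, Matrix.trace (Z c * T (Pi.single b (Matrix.single j i (1 : ℂ))) c)‖ ≤ 2 * β * C_T * v b := by
    intro i j
    refine (pairing_le_of_current Z _ u hZ).trans ?_
    have h1 := (hT (Pi.single b (Matrix.single j i (1 : ℂ)))).trans (mul_le_mul_of_nonneg_left (l1_single v hv b i j) hC_T)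
    calc 2 * β * ∑ c, u c * ‖T (Pi.single b (Matrix.single j i (1 : ℂ))) c‖ ≤ 2 * β * (C_T * v b) := mul_le_mul_of_nonneg_left h1 (by positivity)
      _ = 2 * β * C_T * v b := by ring
  refine (norm_le_sum_norm_entries _).trans ?_
  calc ∑ i : Fin 2, ∑ j : Fin 2, ‖Matrix.of (fun i j : Fin 2 => ∑ c, Matrix.trace (Z c * T (Pi.single b (Matrix.single j i (1 : ℂ))) c)) i j‖
      ≤ ∑ _i : Fin 2, ∑ _j : Fin 2, 2 * β * C_T * v b := Finset.sum_le_sum fun i _ => Finset.sum_le_sum fun j _ => by rw [Matrix.of_apply]; exact hentry i j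
    _ = 8 * β * C_T * v b := by simp only [Finset.sum_const, Finset.card_univ, Fintype.card_fin]; ring

end Transpose

/-! ## §3 The (X2) letters in the knit's currency: `w`-currents (`w = w 3`, `0 < w`), one shared index weight `u` -/

section Letters

variable {ι β' : Type*} [Fintype ι] [Fintype β'] [DecidableEq ι]

omit [Fintype ι] [DecidableEq ι] in
/-- From a `w`-weighted current bound to the dual form: `w b·‖J b‖ ≤ t`, `0 < w b` ⟹ `‖J b‖ ≤ t·(w b)⁻¹`. [folklore] -/
theorem norm_le_mul_inv_of_weighted {w : ι → ℝ} (hw : ∀ b, 0 < w b) (J : ι → Matrix (Fin 2) (Fin 2) ℂ) {t : ℝ} (hJ : ∀ b, w b * ‖J b‖ ≤ t) (b : ι) :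
    ‖J b‖ ≤ t * (w b)⁻¹ := by
  rw [← div_eq_mul_inv, le_div_iff₀ (hw b), mul_comm]
  exact hJ b

/-- ★★ **(X2-D) — THE TRANSPOSE LETTER OF `D′(Y)`**: `D′(Y)ᵀ` maps `u`-dual index currents to `w`-currents with norm `16c₃` (= O(r) through `c₃ = O(size ΨY)`).
Data: ℂ-linear `D′` (:= `fderiv ℂ D Y`), `C′` (:= `fderiv ℂ C (ΨY)`), `H`; the differentiated fixed-point identity `hfix` (`fderiv_fixedPoint_apply`); the column
letters (X2-C′) `hCcol` and (X2-H) `hHcol` (DISPLAYED — the (72)∕(46)-class content); `c₃h₁ ≤ ½`.  Conclusion: for every index current `ξ` with `‖ξ c‖ ≤ β·u c`,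
`w b·‖(Σ_c tr(ξ_c·(D′e_{b,ji})_c))_{ij}‖ ≤ 16c₃·β`. [cite: Balaban1985Variational, (73) p.289, (85)-(86) p.291] -/
theorem X2D_letter (D' C' : (ι → Matrix (Fin 2) (Fin 2) ℂ) →ₗ[ℂ] (β' → Matrix (Fin 2) (Fin 2) ℂ))
    (H : (β' → Matrix (Fin 2) (Fin 2) ℂ) →ₗ[ℂ] (ι → Matrix (Fin 2) (Fin 2) ℂ)) (w : ι → ℝ) (u : β' → ℝ) {c₃ h₁ : ℝ}
    (hw : ∀ b, 0 < w b) (hu : ∀ c, 0 ≤ u c) (hc₃ : 0 ≤ c₃)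
    (hfix : ∀ δ, D' δ = C' (δ - H (D' δ)))
    (hCcol : ∀ δ, ∑ c, u c * ‖C' δ c‖ ≤ c₃ * ∑ b, (w b)⁻¹ * ‖δ b‖)
    (hHcol : ∀ X, ∑ b, (w b)⁻¹ * ‖H X b‖ ≤ h₁ * ∑ c, u c * ‖X c‖)
    (hsmall : c₃ * h₁ ≤ 1 / 2)
    (ξ : β' → Matrix (Fin 2) (Fin 2) ℂ) {β : ℝ} (hβ : 0 ≤ β) (hξ : ∀ c, ‖ξ c‖ ≤ β * u c) (b : ι) :
    w b * ‖Matrix.of (fun i j : Fin 2 => ∑ c, Matrix.trace (ξ c * D' (Pi.single b (Matrix.single j i (1 : ℂ))) c))‖ ≤ 16 * c₃ * β := by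
  have hv : ∀ b, 0 ≤ (w b)⁻¹ := fun b => inv_nonneg.2 (hw b).le
  have hD := l1_fderivD_of_fixedPoint D' C' H (fun b => (w b)⁻¹) u hv hu hc₃ hfix hCcol hHcol hsmall
  have h := norm_transposeCurrent_le D' (fun b => (w b)⁻¹) u hv (by positivity : (0 : ℝ) ≤ 2 * c₃) hβ hD ξ hξ b
  have hwb := hw b
  calc w b * ‖Matrix.of (fun i j : Fin 2 => ∑ c, Matrix.trace (ξ c * D' (Pi.single b (Matrix.single j i (1 : ℂ))) c))‖
      ≤ w b * (8 * β * (2 * c₃) * (w b)⁻¹) := mul_le_mul_of_nonneg_left h hwb.le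
    _ = 16 * c₃ * β := by field_simp; ring

/-- ★★ **(X2-T) — THE TRANSPOSE LETTER OF `T_Y = H∘D′(Y)` ON `w`-CURRENTS** (owner's shape: «`∀ J t, (∀ b, w 3 b‖J b‖ ≤ t) → ∀ b, w 3 b·‖T_Yᵀ J b‖ ≤ B₃·t`»,
here `B₃ := 16h₁c₃`, O(r) through `c₃`): under the data of `X2D_letter` and `0 ≤ h₁`, for every current `J` with `w·‖J‖ ≤ t`,
`w b·‖(Σ_{b′} tr(J_{b′}·(H(D′e_{b,ji}))_{b′}))_{ij}‖ ≤ 16h₁c₃·t` — the letter that makes `E₃ = −T_Yᵀ[W₀(ΨY)]` quadratically small from (98) for `W₀`.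
[cite: Balaban1985Variational, (73) p.289, (89)-(91) p.291] -/
theorem X2T_letter (D' C' : (ι → Matrix (Fin 2) (Fin 2) ℂ) →ₗ[ℂ] (β' → Matrix (Fin 2) (Fin 2) ℂ))
    (H : (β' → Matrix (Fin 2) (Fin 2) ℂ) →ₗ[ℂ] (ι → Matrix (Fin 2) (Fin 2) ℂ)) (w : ι → ℝ) (u : β' → ℝ) {c₃ h₁ : ℝ}
    (hw : ∀ b, 0 < w b) (hu : ∀ c, 0 ≤ u c) (hc₃ : 0 ≤ c₃) (hh₁ : 0 ≤ h₁)
    (hfix : ∀ δ, D' δ = C' (δ - H (D' δ)))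
    (hCcol : ∀ δ, ∑ c, u c * ‖C' δ c‖ ≤ c₃ * ∑ b, (w b)⁻¹ * ‖δ b‖)
    (hHcol : ∀ X, ∑ b, (w b)⁻¹ * ‖H X b‖ ≤ h₁ * ∑ c, u c * ‖X c‖)
    (hsmall : c₃ * h₁ ≤ 1 / 2)
    (J : ι → Matrix (Fin 2) (Fin 2) ℂ) {t : ℝ} (ht : 0 ≤ t) (hJ : ∀ b, w b * ‖J b‖ ≤ t) (b : ι) :
    w b * ‖Matrix.of (fun i j : Fin 2 => ∑ b', Matrix.trace (J b' * H (D' (Pi.single b (Matrix.single j i (1 : ℂ)))) b'))‖ ≤ 16 * h₁ * c₃ * t := by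
  have hv : ∀ b, 0 ≤ (w b)⁻¹ := fun b => inv_nonneg.2 (hw b).le
  have hT := l1_HD_of_fixedPoint D' C' H (fun b => (w b)⁻¹) u hv hu hc₃ hh₁ hfix hCcol hHcol hsmall
  have hJ' : ∀ b, ‖J b‖ ≤ t * (w b)⁻¹ := norm_le_mul_inv_of_weighted hw J hJ
  have h := norm_transposeCurrent_le (H ∘ₗ D') (fun b => (w b)⁻¹) (fun b => (w b)⁻¹) hv (by positivity : (0 : ℝ) ≤ 2 * h₁ * c₃) ht
    (fun δ => by simpa only [LinearMap.comp_apply] using hT δ) J hJ' b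
  have hwb := hw b
  calc w b * ‖Matrix.of (fun i j : Fin 2 => ∑ b', Matrix.trace (J b' * H (D' (Pi.single b (Matrix.single j i (1 : ℂ)))) b'))‖
      = w b * ‖Matrix.of (fun i j : Fin 2 => ∑ b', Matrix.trace (J b' * (H ∘ₗ D') (Pi.single b (Matrix.single j i (1 : ℂ))) b'))‖ := by
        simp only [LinearMap.comp_apply]
    _ ≤ w b * (8 * t * (2 * h₁ * c₃) * (w b)⁻¹) := mul_le_mul_of_nonneg_left h hwb.le
    _ = 16 * h₁ * c₃ * t := by field_simp; ring

/-- ★★ **(X2a) — THE COMPOSITE LETTER FOR `E₂ = −T_Yᵀ[½·CC(ΨY)]`, ROUTED AS IN PRINT (88)**: `T_Yᵀ∘CC = D′ᵀ∘(CC∘H)ᵀ` for ANY map `CC` (no linearity used) that is trace-SYMMETRIC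
(`Σ tr(CC Z·W) = Σ tr(CC W·Z)` — the lattice `∂*∂`), so the (X2-CH) COLUMN LETTER of `CC∘H` at the field `Z` (pairing form, DISPLAYED:
`|Σ_b tr(CC(HX)_b Z_b)| ≤ B_CH·s·Σ_c u_c‖X c‖` — (137) `∂*∂H = Q*((QGQ*)⁻¹ − a)` and [5] (3.132) read on `QZ`) and (X2-D) give
`w b·‖(Σ_{b′} tr(CC Z_{b′}·(H(D′e_{b,ji}))_{b′}))_{ij}‖ ≤ 8c₃B_CH·s` (the knit's `B₂·r·s` with `B₂r := 8c₃B_CH`).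
[cite: Balaban1985Variational, (87)-(88) p.291, (73) p.289] -/
theorem X2a_of_X2D_CCHt (D' C' : (ι → Matrix (Fin 2) (Fin 2) ℂ) →ₗ[ℂ] (β' → Matrix (Fin 2) (Fin 2) ℂ))
    (H : (β' → Matrix (Fin 2) (Fin 2) ℂ) →ₗ[ℂ] (ι → Matrix (Fin 2) (Fin 2) ℂ))
    (CC : (ι → Matrix (Fin 2) (Fin 2) ℂ) → (ι → Matrix (Fin 2) (Fin 2) ℂ)) (w : ι → ℝ) (u : β' → ℝ) {c₃ h₁ B_CH s : ℝ}
    (hw : ∀ b, 0 < w b) (hu : ∀ c, 0 ≤ u c) (hc₃ : 0 ≤ c₃) (hBs : 0 ≤ B_CH * s)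
    (hfix : ∀ δ, D' δ = C' (δ - H (D' δ)))
    (hCcol : ∀ δ, ∑ c, u c * ‖C' δ c‖ ≤ c₃ * ∑ b, (w b)⁻¹ * ‖δ b‖)
    (hHcol : ∀ X, ∑ b, (w b)⁻¹ * ‖H X b‖ ≤ h₁ * ∑ c, u c * ‖X c‖)
    (hsmall : c₃ * h₁ ≤ 1 / 2)
    (hCCsym : ∀ Z W : ι → Matrix (Fin 2) (Fin 2) ℂ, ∑ b, Matrix.trace (CC Z b * W b) = ∑ b, Matrix.trace (CC W b * Z b))
    (Z : ι → Matrix (Fin 2) (Fin 2) ℂ)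
    (hCH : ∀ X : β' → Matrix (Fin 2) (Fin 2) ℂ, ‖∑ b, Matrix.trace (CC (H X) b * Z b)‖ ≤ B_CH * s * ∑ c, u c * ‖X c‖) (b : ι) :
    w b * ‖Matrix.of (fun i j : Fin 2 => ∑ b', Matrix.trace (CC Z b' * H (D' (Pi.single b (Matrix.single j i (1 : ℂ)))) b'))‖ ≤ 8 * c₃ * B_CH * s := by
  have hv : ∀ b, 0 ≤ (w b)⁻¹ := fun b => inv_nonneg.2 (hw b).le
  have hD := l1_fderivD_of_fixedPoint D' C' H (fun b => (w b)⁻¹) u hv hu hc₃ hfix hCcol hHcol hsmall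
  -- entry bound through the symmetry of `CC` and the column letter of `CC∘H`
  have hentry : ∀ i j : Fin 2, ‖∑ b', Matrix.trace (CC Z b' * H (D' (Pi.single b (Matrix.single j i (1 : ℂ)))) b')‖ ≤ 2 * c₃ * B_CH * s * (w b)⁻¹ := by
    intro i j
    rw [hCCsym Z (H (D' (Pi.single b (Matrix.single j i (1 : ℂ)))))]
    refine (hCH (D' (Pi.single b (Matrix.single j i (1 : ℂ))))).trans ?_
    have h1 := (hD (Pi.single b (Matrix.single j i (1 : ℂ)))).trans (mul_le_mul_of_nonneg_left (l1_single (fun b => (w b)⁻¹) hv b i j) (by positivity))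
    calc B_CH * s * ∑ c, u c * ‖D' (Pi.single b (Matrix.single j i (1 : ℂ))) c‖ ≤ B_CH * s * (2 * c₃ * (w b)⁻¹) := mul_le_mul_of_nonneg_left h1 hBs
      _ = 2 * c₃ * B_CH * s * (w b)⁻¹ := by ring
  have hM : ‖Matrix.of (fun i j : Fin 2 => ∑ b', Matrix.trace (CC Z b' * H (D' (Pi.single b (Matrix.single j i (1 : ℂ)))) b'))‖ ≤ 8 * c₃ * B_CH * s * (w b)⁻¹ := by
    refine (norm_le_sum_norm_entries _).trans ?_
    calc ∑ i : Fin 2, ∑ j : Fin 2, ‖Matrix.of (fun i j : Fin 2 => ∑ b', Matrix.trace (CC Z b' * H (D' (Pi.single b (Matrix.single j i (1 : ℂ)))) b')) i j‖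
        ≤ ∑ _i : Fin 2, ∑ _j : Fin 2, 2 * c₃ * B_CH * s * (w b)⁻¹ := Finset.sum_le_sum fun i _ => Finset.sum_le_sum fun j _ => by rw [Matrix.of_apply]; exact hentry i j
      _ = 8 * c₃ * B_CH * s * (w b)⁻¹ := by simp only [Finset.sum_const, Finset.card_univ, Fintype.card_fin]; ring
  have hwb := hw b
  calc w b * ‖Matrix.of (fun i j : Fin 2 => ∑ b', Matrix.trace (CC Z b' * H (D' (Pi.single b (Matrix.single j i (1 : ℂ)))) b'))‖
      ≤ w b * (8 * c₃ * B_CH * s * (w b)⁻¹) := mul_le_mul_of_nonneg_left hM hwb.le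
    _ = 8 * c₃ * B_CH * s := by field_simp

/-! ### The same letters with `D′ := fderiv ℂ D Y`, `C′ := fderiv ℂ C (ΨY)` — the identity `hfix` discharged from (49) near `Y` -/

/-- ★★ **(X2-D) AT `D′ = fderiv ℂ D Y`**: `X2D_letter` with `hfix` discharged by `fderiv_fixedPoint_apply` from the fixed-point equation (49) near `Y` and the
differentiability of `D` at `Y` and of `C` at `ΨY` (column letters (X2-C′) for `fderiv ℂ C (ΨY)` and (X2-H) for `H` displayed).
[cite: Balaban1985Variational, (49) p.285, (73) p.289, (85)-(86) p.291] -/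
theorem X2D_letter_fderiv (C D : (ι → Matrix (Fin 2) (Fin 2) ℂ) → (β' → Matrix (Fin 2) (Fin 2) ℂ))
    (H : (β' → Matrix (Fin 2) (Fin 2) ℂ) →ₗ[ℂ] (ι → Matrix (Fin 2) (Fin 2) ℂ)) (w : ι → ℝ) (u : β' → ℝ) {c₃ h₁ : ℝ}
    (hw : ∀ b, 0 < w b) (hu : ∀ c, 0 ≤ u c) (hc₃ : 0 ≤ c₃) {Y : ι → Matrix (Fin 2) (Fin 2) ℂ}
    (h49 : ∀ᶠ X in 𝓝 Y, D X = C (X - H (D X))) (hD : DifferentiableAt ℂ D Y) (hC : DifferentiableAt ℂ C (Y - H (D Y)))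
    (hCcol : ∀ δ, ∑ c, u c * ‖fderiv ℂ C (Y - H (D Y)) δ c‖ ≤ c₃ * ∑ b, (w b)⁻¹ * ‖δ b‖)
    (hHcol : ∀ X, ∑ b, (w b)⁻¹ * ‖H X b‖ ≤ h₁ * ∑ c, u c * ‖X c‖)
    (hsmall : c₃ * h₁ ≤ 1 / 2)
    (ξ : β' → Matrix (Fin 2) (Fin 2) ℂ) {β : ℝ} (hβ : 0 ≤ β) (hξ : ∀ c, ‖ξ c‖ ≤ β * u c) (b : ι) :
    w b * ‖Matrix.of (fun i j : Fin 2 => ∑ c, Matrix.trace (ξ c * fderiv ℂ D Y (Pi.single b (Matrix.single j i (1 : ℂ))) c))‖ ≤ 16 * c₃ * β :=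
  X2D_letter (fderiv ℂ D Y : (ι → Matrix (Fin 2) (Fin 2) ℂ) →ₗ[ℂ] (β' → Matrix (Fin 2) (Fin 2) ℂ))
    (fderiv ℂ C (Y - H (D Y)) : (ι → Matrix (Fin 2) (Fin 2) ℂ) →ₗ[ℂ] (β' → Matrix (Fin 2) (Fin 2) ℂ)) H w u hw hu hc₃
    (fun δ => fderiv_fixedPoint_apply C D H h49 hD hC δ) hCcol hHcol hsmall ξ hβ hξ b

/-- ★★ **(X2-T) AT `D′ = fderiv ℂ D Y`** — the shape consumed VERBATIM by the dressing term `E₃` of `HalvingDressedCriticality.fderiv_dressed_eq_pairing`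
(`… − η⁴Σ_{b′} tr(W₀(ΨY)_{b′}·(H(fderiv ℂ D Y e_{b,ji}))_{b′})`): `X2T_letter` with `hfix` discharged by `fderiv_fixedPoint_apply`.
[cite: Balaban1985Variational, (49) p.285, (73) p.289, (89)-(91) p.291] -/
theorem X2T_letter_fderiv (C D : (ι → Matrix (Fin 2) (Fin 2) ℂ) → (β' → Matrix (Fin 2) (Fin 2) ℂ))
    (H : (β' → Matrix (Fin 2) (Fin 2) ℂ) →ₗ[ℂ] (ι → Matrix (Fin 2) (Fin 2) ℂ)) (w : ι → ℝ) (u : β' → ℝ) {c₃ h₁ : ℝ}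
    (hw : ∀ b, 0 < w b) (hu : ∀ c, 0 ≤ u c) (hc₃ : 0 ≤ c₃) (hh₁ : 0 ≤ h₁) {Y : ι → Matrix (Fin 2) (Fin 2) ℂ}
    (h49 : ∀ᶠ X in 𝓝 Y, D X = C (X - H (D X))) (hD : DifferentiableAt ℂ D Y) (hC : DifferentiableAt ℂ C (Y - H (D Y)))
    (hCcol : ∀ δ, ∑ c, u c * ‖fderiv ℂ C (Y - H (D Y)) δ c‖ ≤ c₃ * ∑ b, (w b)⁻¹ * ‖δ b‖)
    (hHcol : ∀ X, ∑ b, (w b)⁻¹ * ‖H X b‖ ≤ h₁ * ∑ c, u c * ‖X c‖)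
    (hsmall : c₃ * h₁ ≤ 1 / 2)
    (J : ι → Matrix (Fin 2) (Fin 2) ℂ) {t : ℝ} (ht : 0 ≤ t) (hJ : ∀ b, w b * ‖J b‖ ≤ t) (b : ι) :
    w b * ‖Matrix.of (fun i j : Fin 2 => ∑ b', Matrix.trace (J b' * H (fderiv ℂ D Y (Pi.single b (Matrix.single j i (1 : ℂ)))) b'))‖ ≤ 16 * h₁ * c₃ * t :=
  X2T_letter (fderiv ℂ D Y : (ι → Matrix (Fin 2) (Fin 2) ℂ) →ₗ[ℂ] (β' → Matrix (Fin 2) (Fin 2) ℂ))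
    (fderiv ℂ C (Y - H (D Y)) : (ι → Matrix (Fin 2) (Fin 2) ℂ) →ₗ[ℂ] (β' → Matrix (Fin 2) (Fin 2) ℂ)) H w u hw hu hc₃ hh₁
    (fun δ => fderiv_fixedPoint_apply C D H h49 hD hC δ) hCcol hHcol hsmall J ht hJ b

/-- ★★ **(X2a) AT `D′ = fderiv ℂ D Y`** — the shape consumed by the dressing term `E₂` of `fderiv_dressed_eq_pairing` (`CC` the knit's `η⁻²·Σ_p σ(p,b)·Φ_p`, any
trace-symmetric map): `X2a_of_X2D_CCHt` with `hfix` discharged by `fderiv_fixedPoint_apply`. [cite: Balaban1985Variational, (49) p.285, (87)-(88) p.291] -/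
theorem X2a_fderiv (C D : (ι → Matrix (Fin 2) (Fin 2) ℂ) → (β' → Matrix (Fin 2) (Fin 2) ℂ))
    (H : (β' → Matrix (Fin 2) (Fin 2) ℂ) →ₗ[ℂ] (ι → Matrix (Fin 2) (Fin 2) ℂ))
    (CC : (ι → Matrix (Fin 2) (Fin 2) ℂ) → (ι → Matrix (Fin 2) (Fin 2) ℂ)) (w : ι → ℝ) (u : β' → ℝ) {c₃ h₁ B_CH s : ℝ}
    (hw : ∀ b, 0 < w b) (hu : ∀ c, 0 ≤ u c) (hc₃ : 0 ≤ c₃) (hBs : 0 ≤ B_CH * s) {Y : ι → Matrix (Fin 2) (Fin 2) ℂ}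
    (h49 : ∀ᶠ X in 𝓝 Y, D X = C (X - H (D X))) (hD : DifferentiableAt ℂ D Y) (hC : DifferentiableAt ℂ C (Y - H (D Y)))
    (hCcol : ∀ δ, ∑ c, u c * ‖fderiv ℂ C (Y - H (D Y)) δ c‖ ≤ c₃ * ∑ b, (w b)⁻¹ * ‖δ b‖)
    (hHcol : ∀ X, ∑ b, (w b)⁻¹ * ‖H X b‖ ≤ h₁ * ∑ c, u c * ‖X c‖)
    (hsmall : c₃ * h₁ ≤ 1 / 2)
    (hCCsym : ∀ Z W : ι → Matrix (Fin 2) (Fin 2) ℂ, ∑ b, Matrix.trace (CC Z b * W b) = ∑ b, Matrix.trace (CC W b * Z b))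
    (Z : ι → Matrix (Fin 2) (Fin 2) ℂ)
    (hCH : ∀ X : β' → Matrix (Fin 2) (Fin 2) ℂ, ‖∑ b, Matrix.trace (CC (H X) b * Z b)‖ ≤ B_CH * s * ∑ c, u c * ‖X c‖) (b : ι) :
    w b * ‖Matrix.of (fun i j : Fin 2 => ∑ b', Matrix.trace (CC Z b' * H (fderiv ℂ D Y (Pi.single b (Matrix.single j i (1 : ℂ)))) b'))‖ ≤ 8 * c₃ * B_CH * s :=
  X2a_of_X2D_CCHt (fderiv ℂ D Y : (ι → Matrix (Fin 2) (Fin 2) ℂ) →ₗ[ℂ] (β' → Matrix (Fin 2) (Fin 2) ℂ))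
    (fderiv ℂ C (Y - H (D Y)) : (ι → Matrix (Fin 2) (Fin 2) ℂ) →ₗ[ℂ] (β' → Matrix (Fin 2) (Fin 2) ℂ)) H CC w u hw hu hc₃ hBs
    (fun δ => fderiv_fixedPoint_apply C D H h49 hD hC δ) hCcol hHcol hsmall hCCsym Z hCH b

end Letters

end Summit.QuantumFields.YangMills.Theorems.DressingTransposeLetters

end
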